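import Summits.BirchSwinnertonDyer.BirchSwinnertonDyer.Theorems.AlignedTransportAtTwoBSDOfMainConjectureRankOneAtTwoEulerCharAtTwoRankZero
import Summits.BirchSwinnertonDyer.BirchSwinnertonDyer.Theorems.ByReductionTypeAtTwoEulerCharAtTwoAll
import Summits.BirchSwinnertonDyer.Rank1Residual.X5.RationalTwoTorsionPoints
import HarnessLib

/-!
# Route `AlignedTransportAtTwo`, crux C3′ `BSDOfMainConjectureRankOneAtTwo` (stmt-BirchSwinnertonDyer-23008), line `birth` —
# the rank-ZERO slice of the open stub `F1Sign2.SchneiderLeadingTermFormulaAtTwoSq` is a KERNEL THEOREM for curves with `E[2]` irreducible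
# (no named fact): att-p4 g6's PRINT-conditional scope certificate `…EulerCharAtTwoRankZero` with Greenberg's Thm. 4.1 at `2` DISCHARGED

HONEST FRAMING (cell `bsd-f1-sign2`, WIDTH-5 attach seat `bsd-line-att-p3` g13 under the C3′ lead lineage `bsd-line-att-p1`;
`--supports stmt-BirchSwinnertonDyer-23008 --as helper`). BSD is NOT proved; C3′ is NOT closed (its cell is rank ONE; this file is about rank ZERO
and closes nothing there). THEOREMS ONLY (no `def`, no named fact, no `sorry`).

WHAT IS PROVED. `…EulerCharAtTwoRankZero` (att-p4 g6, p625xxx) showed: for `W/ℚ` globally minimal with `E(ℚ)` finite, Greenberg's Thm. 4.1 at `2`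
(the named PRINT fact `h41 : Greenberg1999.thm41_charValue_rankZero_anyPrime`, used only through its `p = 2` clause for `W`) implies the
`Γ`-Euler-characteristic statement for `W` and hence the per-curve open stub `SchneiderLeadingTermFormulaAtTwoSqAt W`. Cell `bsd-2adic`
(`Theorems/ByReductionTypeAtTwoEulerCharAtTwoAll.lean`, tower-1 GEN 25) PROVED that `p = 2` clause — `O1.TwoAdicEulerCharRankZero W 0` — for every
`W` with `E[2]` irreducible / without rational `2`-torsion (`GreenbergEulerChar.twoAdicEulerCharRankZero_of_irr`, `…_of_noTwoTorsion`,
`…_of_not_dvd_torsionOrder`). This file composes the two: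

* §1 `eulerCharAt_of_twoAdicEulerCharRankZero_of_finite` — att-p4's §1 with the hypothesis `h41` replaced by the per-curve `p = 2` clause
  `hEC : O1.TwoAdicEulerCharRankZero W 0` (word-for-word the same proof; the clause is consumed as `hEC hord κ γ …` + `zpow_natCast`).
* §2 **`schneiderLeadingTermFormulaAtTwoSqAt_of_finite_of_irr`** — for `W/ℚ` globally minimal with `E(ℚ)` FINITE and `E[2]` IRREDUCIBLE,
  `SchneiderLeadingTermFormulaAtTwoSqAt W` HOLDS — NO hypothesis, NO named fact; variants `…_of_noTwoTorsion` (`E(ℚ)[2] = 0`),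
  `…_of_not_dvd_torsionOrder` (`2 ∤ #E(ℚ)_tors`), `…_of_forall_not_hasRationalTwoTorsionX` (the route's cell binder).
* §3 `schneiderLeadingTermFormulaAtTwoSq_rankZero_noTwoTorsion` — packaged: the `@[conjecture]` cell statement `SchneiderLeadingTermFormulaAtTwoSq`
  restricted to {`E(ℚ)` finite, `E(ℚ)[2] = 0`} is a theorem.

READING (for disprovers of `stub_leadingTermFormulaAtTwo` / (H) / (H′) and for the planner): a counterexample to the registered open stub must have
`rank E(ℚ) ≥ 1` OR a rational point of order `2` — now UNCONDITIONALLY (att-p4's certificate said so modulo Thm. 4.1 at `2` as a named fact). On the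
C2 seed cell (r_an = 0, no rational `2`-torsion) the formula holds for every curve of rank `0`. Beyond print: no (Greenberg Thm. 4.1 is print; the
kernel value is the discharge). Closes nothing on the rank-one cell C3′.

References: [GreenbergLNM1716] Thm. 4.1 (p. 102), Lemma 4.2, §3 Lemma 3.4 (p. 89); [CoatesSchneiderSujatha2003] p. 203 (Case 1), §3 (30)–(31);
[MazurTateTeitelbaum1986Invent] §II.4 (empty regulator `= 1`); [BalakrishnanMullerStein2015] Thm. 1.7 (3).
bears_on: stmt-BirchSwinnertonDyer-23008 (helper; closes nothing), stmt-BirchSwinnertonDyer-22298 (attach seat's item; untouched).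
-/

set_option autoImplicit false
-- the route's Theorems namespace repeats a component by design (summit = sub-problem, D-0017).
set_option linter.dupNamespace false

noncomputable section

open scoped Classical

open WeierstrassCurve Literature.NumberTheory.EllipticCurves Literature.NumberTheory.EllipticCurves.IwasawaAlgebra
  Literature.NumberTheory.EllipticCurves.Greenberg1999 Summit.BirchSwinnertonDyer.Rank1Residual.F1Sign2
  Summit.BirchSwinnertonDyer.BirchSwinnertonDyer.Theorems.AlignedTransportAtTwoEulerCharAtTwo
  Summit.BirchSwinnertonDyer.Rank1Residual.X5

namespace Summit.BirchSwinnertonDyer.BirchSwinnertonDyer.Theorems.AlignedTransportAtTwoEulerCharAtTwoRankZeroKernel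

/-! ## §1 Rank `0`: the `p = 2` clause of Thm. 4.1 for `W` ⟹ the `Γ`-Euler-characteristic statement for `W` -/

/-- **Rank-`0` slice from the PER-CURVE `p = 2` clause of Greenberg's Thm. 4.1** (`hEC : O1.TwoAdicEulerCharRankZero W 0`, slot `δ = 0`): for
`W/ℚ` globally minimal, good ordinary at `2`, with `E(ℚ)` finite, the `Γ`-Euler-characteristic statement of p624996 for `W` — every cyclotomic
datum, every finitely generated torsion strict-at-`∞` dual `X = D.X`, every `2`-adic height datum (`Reg₂ = 1` in rank `0`), given `Ш(E/ℚ)(2)`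
finite: `ker φ_X` finite and `#coker φ_X·(log₂5)^0·#E(ℚ)(2)² = u·#ker φ_X·Reg₂·#Ш(2)·2^{v₂(∏c_v)}·#Ẽ(𝔽₂)(2)²`. Word for word att-p4 g6's
`…EulerCharAtTwoRankZero.eulerCharAt_of_thm41_of_finite` with the named fact `h41` (used there only through this clause) replaced by `hEC`.
[cite: GreenbergLNM1716, Thm. 4.1 and Lemma 4.2] [cite: CoatesSchneiderSujatha2003, p. 203 (Case 1)] -/
theorem eulerCharAt_of_twoAdicEulerCharRankZero_of_finite
    (W : WeierstrassCurve ℚ) [W.IsElliptic] [W.IsGloballyMinimal] [Finite W.toAffine.Point]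
    (hEC : O1.TwoAdicEulerCharRankZero W 0) :
    W.HasGoodReductionAtPrime 2 → ¬ (2 : ℤ) ∣ W.frobeniusTrace 2 →
      ∀ (κ : ZpExtension ℚ 2) (γ : Field.absoluteGaloisGroup ℚ),
        κ.IsCyclotomic → κ.IsTopGenerator γ → IsCyclotomicVariable 2 γ →
      ∀ (D : W.SelmerDualData κ γ) [Module.Finite (IwasawaAlgebra 2) D.X], D.IsTorsion →
      ∀ (Dh : PAdicHeightData W 2), Dh.IsCanonicalSq →
        SchneiderConjecture Dh → Finite (AddCommGroup.primaryComponent W.sha 2) →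
        Finite (LinearMap.ker (bockstein 2 D.X)) ∧
        ∃ u : ℤ_[2]ˣ,
          (Nat.card (coinvariants 2 D.X ⧸ LinearMap.range (bockstein 2 D.X)) : ℚ_[2]) *
              padicLog 2 (cyclotomicGenerator 2) ^ W.mordellWeilRank *
              (Nat.card (AddCommGroup.primaryComponent W.toAffine.Point 2) : ℚ_[2]) ^ 2 =
            ((u : ℤ_[2]) : ℚ_[2]) * Nat.card (LinearMap.ker (bockstein 2 D.X)) * padicRegulator Dh *
              Nat.card (AddCommGroup.primaryComponent W.sha 2) * (2 : ℚ_[2]) ^ (padicValNat 2 W.tamagawaProduct) *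
              (Nat.card (AddCommGroup.primaryComponent
                ((integralModelInt W).map (Int.castRingHom (ZMod 2))).toAffine.Point 2) : ℚ_[2]) ^ 2 := by
  intro hg ho κ γ hκ hγ hγ' D _ hX Dh _ _ hSha
  haveI : NeZero (2 : ℕ) := ⟨two_ne_zero⟩
  have hord : IsOrdinaryAt W 2 := ⟨hg, ho⟩
  have hr : W.mordellWeilRank = 0 := W.mordellWeilRank_eq_zero_iff_finite.mpr ‹_›
  have hReg : padicRegulator Dh = 1 := padicRegulator_eq_one_of_finite W 2 Dh
  haveI : Finite (AddCommGroup.primaryComponent W.sha 2) := hSha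
  have hSel : Finite (W.selmerGroupPInfty 2) := W.finite_selmerGroupPInfty_of_finite_primaryComponent 2
  have hcardSel : Nat.card (W.selmerGroupPInfty 2) = Nat.card (AddCommGroup.primaryComponent W.sha 2) :=
    W.natCard_selmerGroupPInfty_eq_natCard_primaryComponent_sha 2
  -- a characteristic generator and the `p = 2` clause of Thm. 4.1 for `W`
  obtain ⟨fE, hchar⟩ := (charIdeal_isPrincipal_holds 2 D.X).principal
  obtain ⟨u, hu⟩ := hEC hord κ γ hκ hγ hγ' D hX fE hchar hSel
  rw [add_zero, zpow_natCast] at hu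
  -- `f_E(0) ≠ 0`, so `ord f_E = 0 = rank` and `ker φ_X` is finite
  have hNp0 : (Nat.card (AddCommGroup.primaryComponent
      ((integralModelInt W).map (Int.castRingHom (ZMod 2))).toAffine.Point 2) : ℚ_[2]) ≠ 0 := by
    haveI : Finite ((integralModelInt W).map (Int.castRingHom (ZMod 2))).toAffine.Point :=
      Nat.finite_of_card_ne_zero (W.reductionPointCount_pos 2).ne'
    exact_mod_cast Nat.card_pos.ne'
  have hSel0 : (Nat.card (W.selmerGroupPInfty 2) : ℚ_[2]) ≠ 0 := by exact_mod_cast Nat.card_pos.ne'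
  have hf0 : PowerSeries.constantCoeff fE ≠ 0 := by
    intro h0
    have h := hu
    rw [h0] at h
    simp only [PadicInt.coe_zero, zero_mul] at h
    exact (mul_ne_zero (mul_ne_zero (mul_ne_zero (coe_units_ne_zero 2 u) (pow_ne_zero _ two_ne_zero))
      (pow_ne_zero 2 hNp0)) hSel0) h.symm
  have heq : fE.order = W.mordellWeilRank := by
    have hc : PowerSeries.coeff W.mordellWeilRank fE ≠ 0 := by
      rw [hr, PowerSeries.coeff_zero_eq_constantCoeff_apply]; exact hf0
    exact (order_eq_mordellWeilRank_iff_coeff_ne_zero W hγ D hX fE hchar).mpr hc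
  have hfin : Finite (LinearMap.ker (bockstein 2 D.X)) :=
    (order_eq_mordellWeilRank_iff_finite_ker_bockstein W 2 ⟨hg, ho⟩ hκ hγ D hX fE hchar hSha).mp heq
  refine ⟨hfin, ?_⟩
  -- `f_E(0)·#ker φ_X = u₁·#coker φ_X`
  obtain ⟨u₁, hu₁⟩ := coeff_charGenerator_mul_card_ker_bockstein_of_order_eq 2 D.X hX fE hchar (n := 0)
    (by rw [heq, hr]) hfin
  rw [PowerSeries.coeff_zero_eq_constantCoeff_apply] at hu₁
  -- abbreviations
  set c : ℚ_[2] := ((PowerSeries.constantCoeff fE : ℤ_[2]) : ℚ_[2]) with hc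
  set Kk : ℚ_[2] := (Nat.card (LinearMap.ker (bockstein 2 D.X)) : ℚ_[2]) with hK
  set C : ℚ_[2] := (Nat.card (coinvariants 2 D.X ⧸ LinearMap.range (bockstein 2 D.X)) : ℚ_[2]) with hC
  set Tp : ℚ_[2] := (Nat.card (AddCommGroup.primaryComponent W.toAffine.Point 2) : ℚ_[2]) with hTp
  set Np : ℚ_[2] := (Nat.card (AddCommGroup.primaryComponent
    ((integralModelInt W).map (Int.castRingHom (ZMod 2))).toAffine.Point 2) : ℚ_[2]) with hNp
  set Sh : ℚ_[2] := (Nat.card (AddCommGroup.primaryComponent W.sha 2) : ℚ_[2]) with hSh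
  set v := padicValNat 2 W.tamagawaProduct with hv
  have H1 : c * Kk = ((u₁ : ℤ_[2]) : ℚ_[2]) * C := by
    have := congrArg ((↑) : ℤ_[2] → ℚ_[2]) hu₁
    push_cast at this
    rw [hc, hK, hC]
    exact_mod_cast this
  -- Thm. 4.1's clause in the abbreviations: `c·Tp² = u·2^v·Np²·Sh`
  have H41 : c * Tp ^ 2 = ((u : ℤ_[2]) : ℚ_[2]) * (2 : ℚ_[2]) ^ v * Np ^ 2 * Sh := by
    rw [hc, hTp, hNp, hSh, hv, ← hcardSel]; exact_mod_cast hu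
  have hu₁0 : ((u₁ : ℤ_[2]) : ℚ_[2]) ≠ 0 := coe_units_ne_zero 2 u₁
  -- the unit `u′ = u·u₁⁻¹`
  set U : ℤ_[2]ˣ := u * u₁⁻¹ with hU
  have hUval : ((U : ℤ_[2]) : ℚ_[2]) * ((u₁ : ℤ_[2]) : ℚ_[2]) = ((u : ℤ_[2]) : ℚ_[2]) := by
    have h : (((U * u₁ : ℤ_[2]ˣ) : ℤ_[2]) : ℚ_[2]) = (((u : ℤ_[2]ˣ) : ℤ_[2]) : ℚ_[2]) := by
      rw [hU, inv_mul_cancel_right]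
    simpa [Units.val_mul] using h
  refine ⟨U, ?_⟩
  rw [hr, pow_zero, mul_one, hReg, mul_one]
  apply mul_right_cancel₀ hu₁0
  calc C * Tp ^ 2 * ((u₁ : ℤ_[2]) : ℚ_[2]) = (((u₁ : ℤ_[2]) : ℚ_[2]) * C) * Tp ^ 2 := by ring
    _ = c * Kk * Tp ^ 2 := by rw [← H1]
    _ = Kk * (c * Tp ^ 2) := by ring
    _ = Kk * (((u : ℤ_[2]) : ℚ_[2]) * (2 : ℚ_[2]) ^ v * Np ^ 2 * Sh) := by rw [H41]
    _ = (((U : ℤ_[2]) : ℚ_[2]) * ((u₁ : ℤ_[2]) : ℚ_[2])) * Kk * Sh * (2 : ℚ_[2]) ^ v * Np ^ 2 := by rw [hUval]; ring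
    _ = ((U : ℤ_[2]) : ℚ_[2]) * Kk * Sh * (2 : ℚ_[2]) ^ v * Np ^ 2 * ((u₁ : ℤ_[2]) : ℚ_[2]) := by ring

/-! ## §2 Rank `0`, `E[2]` irreducible: the per-curve open stub of C3′ HOLDS — no hypothesis, no named fact -/

/-- **THE RANK-`0` SLICE OF THE OPEN STUB IS A KERNEL THEOREM FOR `E[2]` IRREDUCIBLE.** For `W/ℚ` globally minimal with `E(ℚ)` finite and
`E[2]` irreducible (`Irr W 2`), `SchneiderLeadingTermFormulaAtTwoSqAt W` — the registered open stub `stub_leadingTermFormulaAtTwo` of C3′ read at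
`W` — HOLDS, unconditionally: cell `bsd-2adic`'s `GreenbergEulerChar.twoAdicEulerCharRankZero_of_irr` (Greenberg's Thm. 4.1 at `2` in the kernel)
fed to §1 and to p624996's `schneiderLeadingTermFormulaAtTwoSqAt_iff_eulerCharAt`. (The stub's own binders supply good ordinary reduction at `2`.)
[cite: GreenbergLNM1716, Thm. 4.1 (p. 102) and §3 Lemma 3.4 (p. 89)] [cite: BalakrishnanMullerStein2015, Thm. 1.7 (3)] -/
theorem schneiderLeadingTermFormulaAtTwoSqAt_of_finite_of_irr (W : WeierstrassCurve ℚ) [W.IsElliptic] [W.IsGloballyMinimal]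
    [Finite W.toAffine.Point] (hirr : Literature.NumberTheory.EllipticCurves.Rank1Residual.Irr W 2) :
    SchneiderLeadingTermFormulaAtTwoSqAt W :=
  (schneiderLeadingTermFormulaAtTwoSqAt_iff_eulerCharAt W).mpr
    (eulerCharAt_of_twoAdicEulerCharRankZero_of_finite W (GreenbergEulerChar.twoAdicEulerCharRankZero_of_irr W hirr))

/-- **Rank `0`, no `2`-torsion point (`E(ℚ)[2] = 0`): the per-curve open stub holds** (kernel; `GreenbergEulerChar.twoAdicEulerCharRankZero_of_noTwoTorsion`).
[cite: GreenbergLNM1716, Thm. 4.1 (p. 102)] -/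
theorem schneiderLeadingTermFormulaAtTwoSqAt_of_finite_of_noTwoTorsion (W : WeierstrassCurve ℚ) [W.IsElliptic] [W.IsGloballyMinimal]
    [Finite W.toAffine.Point] (hK : ∀ P : W.toAffine.Point, 2 • P = 0 → P = 0) :
    SchneiderLeadingTermFormulaAtTwoSqAt W :=
  (schneiderLeadingTermFormulaAtTwoSqAt_iff_eulerCharAt W).mpr
    (eulerCharAt_of_twoAdicEulerCharRankZero_of_finite W (GreenbergEulerChar.twoAdicEulerCharRankZero_of_noTwoTorsion W hK))

/-- **Rank `0`, `2 ∤ #E(ℚ)_tors`: the per-curve open stub holds** (kernel; `GreenbergEulerChar.twoAdicEulerCharRankZero_of_not_dvd_torsionOrder`).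
[cite: GreenbergLNM1716, Thm. 4.1 (p. 102)] -/
theorem schneiderLeadingTermFormulaAtTwoSqAt_of_finite_of_not_dvd_torsionOrder (W : WeierstrassCurve ℚ) [W.IsElliptic]
    [W.IsGloballyMinimal] [Finite W.toAffine.Point] (htors : ¬ 2 ∣ W.torsionOrder) :
    SchneiderLeadingTermFormulaAtTwoSqAt W :=
  (schneiderLeadingTermFormulaAtTwoSqAt_iff_eulerCharAt W).mpr
    (eulerCharAt_of_twoAdicEulerCharRankZero_of_finite W (GreenbergEulerChar.twoAdicEulerCharRankZero_of_not_dvd_torsionOrder W htors))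

/-- **Rank `0`, no rational `2`-torsion abscissa (the route's cell binder `∀ x, ¬ HasRationalTwoTorsionX W x`): the per-curve open stub holds**
(kernel; the binder gives `E[2]` irreducible — Silverman III.2.3, computation inlined).
[cite: GreenbergLNM1716, Thm. 4.1 (p. 102)] [cite: SilvermanAEC2009, III.2.3] -/
theorem schneiderLeadingTermFormulaAtTwoSqAt_of_finite_of_forall_not_hasRationalTwoTorsionX (W : WeierstrassCurve ℚ) [W.IsElliptic]
    [W.IsGloballyMinimal] [Finite W.toAffine.Point] (ht : ∀ x : ℚ, ¬ HasRationalTwoTorsionX W x) :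
    SchneiderLeadingTermFormulaAtTwoSqAt W := by
  refine schneiderLeadingTermFormulaAtTwoSqAt_of_finite_of_irr W ?_
  -- `E[2]` irreducible: a rational point `P = (x, y)` of order `2` would give `2y + a₁x + a₃ = 0`, i.e. `HasRationalTwoTorsionX W x`
  -- (the computation of `…AlignedTransportAtTwoSeed.irr_two_of_forall_not_hasRationalTwoTorsionX`, inlined to keep this helper light).
  rw [O1.irr_two_iff_not_exists_addOrderOf_eq_two]
  rintro ⟨P, hP⟩
  have h2 : (2 : ℕ) • P = 0 := by rw [← hP]; exact addOrderOf_nsmul_eq_zero P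
  have hP0 : P ≠ 0 := by
    rintro rfl
    rw [addOrderOf_zero] at hP
    exact absurd hP (by norm_num)
  rcases P with _ | ⟨x, y, hns⟩
  · exact absurd rfl hP0
  · refine ht x ⟨y, hns.1, ?_⟩
    have hneg : (WeierstrassCurve.Affine.Point.some x y hns : W.toAffine.Point) =
        -WeierstrassCurve.Affine.Point.some x y hns :=
      eq_neg_of_add_eq_zero_left (by rwa [two_nsmul] at h2)
    rw [WeierstrassCurve.Affine.Point.neg_some, WeierstrassCurve.Affine.Point.some.injEq] at hneg
    have hy : y = -y - W.a₁ * x - W.a₃ := hneg.2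
    linear_combination hy

/-! ## §3 Packaged: the `@[conjecture]` cell statement restricted to {rank `0`, `E(ℚ)[2] = 0`} is a theorem -/

/-- **`SchneiderLeadingTermFormulaAtTwoSq` ON THE RANK-ZERO, NO-`2`-TORSION LOCUS — A THEOREM** (no hypothesis beyond the locus): for every
`W/ℚ` globally minimal elliptic with `E(ℚ)` finite and `E(ℚ)[2] = 0`, the per-curve leading-term formula at `2` holds. So a counterexample to the
cell conjecture `F1Sign2.SchneiderLeadingTermFormulaAtTwoSq` (the registered open stub of C3′) must have `rank E(ℚ) ≥ 1` or a rational point of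
order `2` — UNCONDITIONALLY (att-p4 g6's scope certificate said so modulo Greenberg's Thm. 4.1 at `2` as a named fact).
[cite: GreenbergLNM1716, Thm. 4.1 (p. 102)] [cite: BalakrishnanMullerStein2015, Thm. 1.7 (3)] -/
theorem schneiderLeadingTermFormulaAtTwoSq_rankZero_noTwoTorsion :
    ∀ (W : WeierstrassCurve ℚ) [W.IsElliptic] [W.IsGloballyMinimal], Finite W.toAffine.Point →
      (∀ P : W.toAffine.Point, 2 • P = 0 → P = 0) → SchneiderLeadingTermFormulaAtTwoSqAt W := by
  intro W _ _ hfin hK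
  haveI := hfin
  exact schneiderLeadingTermFormulaAtTwoSqAt_of_finite_of_noTwoTorsion W hK

end Summit.BirchSwinnertonDyer.BirchSwinnertonDyer.Theorems.AlignedTransportAtTwoEulerCharAtTwoRankZeroKernel

end
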